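import Mathlib
import Literature.NumberTheory.LFunctions.AsymptoticLargeSieve
import Literature.NumberTheory.LFunctions.LevelOneCentralValuesWeightAspect
import HarnessLib

/-!
# Conrey–Iwaniec–Soundararajan, *Asymptotic large sieve* (arXiv:1105.1176), Theorem 2.3 in degree
# two: the long range `N ≤ Q^{2−ε}` for coefficients `a_m = m^{−1/2} Σ_{lr=m} λ_f(l) ρ(r)` built from
# a level-one Hecke eigenform `f` and a factor sequence `ρ` of length `X ≤ Q^{1−ε}`

Topic `Literature/NumberTheory/LFunctions` (namespace
`Literature.NumberTheory.LFunctions.AsymptoticLargeSieve`, continuing `AsymptoticLargeSieve.lean`,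
which types §2's objects `𝒮(𝒜×ℬ)`, `𝒮_diag`, (2.2)–(2.4) and Proposition 2.1 / Theorems 2.2 / 2.4
and is CITED here, nothing re-declared). STATEMENT LAYER (D-0014): ONE named fact — Theorem 2.3 in
the special case the tree can state honestly: the `L`-function `𝓛(s) = Σ λ(l) l^{−s}` of (2.6) is
`L(s,f)` for `f ∈ H_k(1)` a normalised Hecke eigen cusp form of level `1` (the tree's
`LevelOneCentralValues.primitiveForms k`, coefficients `λ_f = LevelOneCentralValues.heckeLambda f`,
file `LevelOneCentralValuesWeightAspect.lean`): an `L`-function of degree `g = 2` in the sense of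
[IK, §5.1] all of whose twists `L(s, f ⊗ χ)` by primitive characters are entire ("no character is
singular"), so the printed hypotheses hold and the printed conclusion is (2.19) for `N ≤ Q^{2−ε}`,
`X ≤ Q^{1−ε}` (2.22). Typed for the Landau–Siegel programme (rung F-S3, §C, completing harvest row
T-051; §B-len START-HERE): this is the printed LENGTH statement behind mollification of GL(2)
families ON AVERAGE OVER `χ (mod q)`, `q ≍ Q` — mollifier length `X` up to `Q^{1−ε}`, forms of
length `N` up to `Q^{2−ε}` — the `θ < 1` side of E*-len in the family; no single-modulus or
exceptional-character content.

## What the source prints (held text `paper:arxiv-1105.1176`, corpus-tex chunks p0006–p0007, read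
## 2026-08-26; equation tags as extracted: (24) = (2.4), (25) = (2.5), (26) = (2.6), (219) = (2.19))

§2 (p0006:L47–72): "We assume `|a_m| ≤ m^{−1/2} τ(m)^A`, `|b_n| ≤ n^{−1/2} τ(n)^A` (2.4). … In
applications our coefficients appear as the convolution `a_m = (1/√m) Σ_{lr=m} λ(l) ρ(r)` (2.5) with
`λ(l)` being the coefficients of an `L`-function `𝓛(s) = Σ_l λ(l) l^{−s}` (2.6) and `ρ(r)` being the
coefficients of `𝓛(s)^{−1}` modified by smooth weights supported on `1 ≤ r ≤ X` (2.7). … We shall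
succeed with `𝓛(s)` having the Euler product of degree `g ≤ 3` (barely missing degree four).
Therefore `|λ(l)| ≤ τ_g(l)`, `|ρ(r)| ≤ τ_g(r)`, `|a_m| ≤ m^{−1/2} τ(m) τ_g(m) ≤ m^{−1/2} τ(m)^g`,
hence (2.4) holds with `A = g`."

> **Theorem 2.2** (p0007:L22–30; typed: `conreyIwaniecSoundararajanALS_theorem22`). For any
> complex numbers `a_m, b_n` satisfying (2.4) and `F(m,n)` satisfying (2.3) with `N ≤ Q^{1−ε}` we
> have `𝒮(𝒜×ℬ) = 𝒮_diag(𝒜×ℬ) + O(Q (log Q)^{−C})` (2.19) for any `C > 0`, the implied constant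
> depends only on `ε`, `C` and `A` in (2.4).

> **Theorem 2.3** (p0007:L45–66). Let `𝒜 = (a_m)` be given by (2.5) with any complex numbers
> `ρ(r)` for `1 ≤ r ≤ X` satisfying `|ρ(r)| ≤ τ(r)^A` (2.20) for some constant `A ≥ 0`. Moreover,
> suppose that the `L`-function (2.6) has Euler product of degree `g ≤ 3`, and no character is
> singular for `𝓛(s)`, i.e. `𝓛(s,χ) = Σ_1^∞ λ(l) χ(l) l^{−s}` (2.21) is entire for all `χ`. Assume
> similar conditions for `ℬ = (b_n)`. Then (2.19) holds if `N ≤ Q^{2−ε}` and `X ≤ Q^{1−ε}` if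
> `g = 1, 2` (2.22), `X ≤ Q^{1/2}` if `g = 3` (2.23).
> **Note.** It needs to be said that by an `L`-function we mean one of those whose twists by
> primitive characters satisfy proper functional equation, see Section 5.1 of [IK].
> (p0007:L74: "Actually the case of degree `g = 1` is void in the statement of Theorem 2.3" — `ζ`
> has a pole; that case is Theorem 2.4 with the cancellation condition (2.24), typed.)

## Lean rendering / design choices

* SPECIAL CASE, NOT THE CLASS. The tree has no structure for "`L`-function of degree `g` in the
  sense of [IK §5.1] with all twists entire" (its `SelbergDatum` / `StandardLFunctionData` do not
  pin twisted gamma factors and conductors), and a general rendering would risk asserting more than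
  print. The degree-two instance print itself names in §1 ("a Hecke eigencuspform on `SL₂(ℤ)` …
  no character is singular", p0003:L69–71) is stated instead: `λ = heckeLambda f` for
  `f ∈ primitiveForms k` (normalised Hecke eigenform of level `1`, weight `k`; Deligne's bound gives
  `|λ_f(l)| ≤ τ(l)`, and every twist `L(s, f ⊗ χ)` is entire). `ℬ` is built the same way from a
  second form `f′ ∈ primitiveForms k′` and its own factor sequence.
  `-- TODO(general form): degree g ≤ 3 L-functions in the sense of [IK §5.1] with all twists entire`
  `-- (g = 3: X ≤ Q^{1/2}, (2.23)); needs an L-function class carrying twisted functional equations.`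
* COEFFICIENTS. `heckeTwistedCoeff f ρ m = m^{−1/2} Σ_{(l,r) : lr = m} λ_f(l) ρ(r)` (sum over
  `Nat.divisorsAntidiagonal m`; `a_0 = 0`). "`ρ(r)` for `1 ≤ r ≤ X` with `|ρ(r)| ≤ τ(r)^A`" =
  `IsFactorSequence A X ρ` (support in `[1,X]`, divisor-power bound; NO cancellation condition —
  that is (2.24), needed only for `g = 1`).
* CONSTANTS. "(2.19) holds … the implied constant depends only on `ε`, `C`, `A`" is printed for
  Theorem 2.2; for Theorem 2.3 print is silent on the dependence on `𝓛`, so the fact lets the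
  constant depend on `Ψ, ε, C, A` AND on the two forms (weaker, safe), uniformly in `Q ≥ 2`,
  `2 ≤ N ≤ Q^{2−ε}`, `1 ≤ X ≤ Q^{1−ε}`, the factor sequences and the test function `F` of (2.2)–(2.3)
  (`IsBoxTestFunction N F`), exactly as `conreyIwaniecSoundararajanALS_theorem22` is typed.
* No instances, no notation; imports the two landed anchor files + Mathlib.

## Deliberately not here

The degree-3 case (2.23) and the general [IK §5.1] class (see TODO); §§9–12 (the proof); the
applications [CIS critical zeros] (typed in `CriticalZerosDirichletFamily.lean`) and to GL(2)
families.

References: [cite: ConreyIwaniecSoundararajan2011ALS, §2 (2.4)–(2.7), (2.20)–(2.23), Theorem 2.3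
and Note; §1 p0003:L69–71]; [cite: Deligne1974, Théorème 8.2 (|λ_f(p)| ≤ 2, the degree-2 instance of
"|λ(l)| ≤ τ_g(l)")].

«The programme SEARCHES and TYPES; no claim about Landau–Siegel zeros, Theorems 1–2 of
arXiv:2211.02515 or a repaired Margin232 until a kernel theorem says so.»
-/

noncomputable section

open scoped Classical MatrixGroups
open Complex Finset

namespace Literature.NumberTheory.LFunctions

namespace AsymptoticLargeSieve

open LevelOneCentralValues (primitiveForms heckeLambda)

/-! ### The degree-two coefficients (2.5) and the factor sequences (2.7), (2.20) -/

/-- The convolution coefficients (2.5) for `𝓛 = L(s,f)`: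
`a_m = m^{−1/2} Σ_{lr = m} λ_f(l) ρ(r)` (`a_0 = 0`).
[cite: ConreyIwaniecSoundararajan2011ALS, §2 (2.5)–(2.6)] -/
def heckeTwistedCoeff {k : ℤ} (f : CuspForm 𝒮ℒ k) (ρ : ℕ → ℂ) (m : ℕ) : ℂ :=
  (((m : ℝ) ^ (-(1 / 2 : ℝ)) : ℝ) : ℂ) *
    ∑ d ∈ m.divisorsAntidiagonal, heckeLambda f d.1 * ρ d.2

/-- "`ρ(r)` for `1 ≤ r ≤ X` satisfying `|ρ(r)| ≤ τ(r)^A`" ((2.7), (2.20)): `ρ` is supported on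
`1 ≤ r ≤ X` and bounded by the `A`-th power of the divisor function.
[cite: ConreyIwaniecSoundararajan2011ALS, §2 (2.7), (2.20)] -/
def IsFactorSequence (A X : ℝ) (ρ : ℕ → ℂ) : Prop :=
  (∀ r : ℕ, ρ r ≠ 0 → 1 ≤ r ∧ (r : ℝ) ≤ X) ∧
    ∀ r : ℕ, 1 ≤ r → ‖ρ r‖ ≤ ((ArithmeticFunction.sigma 0 r : ℕ) : ℝ) ^ A

/-! ### Theorem 2.3, degree two -/

-- TODO(general form): degree g ≤ 3 L-functions in the sense of [IK §5.1] with all twists entire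
-- (g = 3: X ≤ Q^{1/2}, (2.23)); needs an L-function class carrying twisted functional equations.
/-- **Conrey–Iwaniec–Soundararajan, Asymptotic Large Sieve, Theorem 2.3** (degree `g = 2`, level-one
Hecke eigenforms). Let `f ∈ H_k(1)`, `f′ ∈ H_{k′}(1)` be normalised Hecke eigen cusp forms of level
`1`, `𝒜 = (a_m)`, `ℬ = (b_n)` the coefficients (2.5) built from `λ_f`, `λ_{f′}` and factor sequences
`ρ, ρ′` supported on `[1,X]` with `|ρ(r)| ≤ τ(r)^A` (2.20). Then for `N ≤ Q^{2−ε}` and `X ≤ Q^{1−ε}`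
(2.22), (2.19) holds: `𝒮(𝒜×ℬ) = 𝒮_diag(𝒜×ℬ) + O(Q (log Q)^{−C})` for every `C > 0` and every test
function `F` of (2.2)–(2.3); the implied constant may depend on `Ψ, ε, C, A, f, f′`. (The printed
hypotheses — degree `≤ 3`, all character twists entire — hold for `L(s,f)`.) Status: preprint claim,
unrefereed (arXiv:1105.1176 has no journal version; used in print by CIS, Crelle 2013)
[claim: ConreyIwaniecSoundararajan2011ALS, status: under-review] (named fact).
[cite: ConreyIwaniecSoundararajan2011ALS, Theorem 2.3 with (2.22) (case g = 2)] -/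
def conreyIwaniecSoundararajanALS_theorem23_degreeTwo : Prop :=
  ∀ Ψ : ℝ → ℝ, IsFamilyWeight Ψ →
    ∀ ε C A : ℝ, 0 < ε → 0 < C → 0 ≤ A →
      ∀ (k k' : ℤ) (f : CuspForm 𝒮ℒ k) (f' : CuspForm 𝒮ℒ k'),
        f ∈ primitiveForms k → f' ∈ primitiveForms k' →
          ∃ c : ℝ, ∀ Q N X : ℝ, 2 ≤ Q → 2 ≤ N → N ≤ Q ^ (2 - ε) → 1 ≤ X → X ≤ Q ^ (1 - ε) →
            ∀ ρ ρ' : ℕ → ℂ, IsFactorSequence A X ρ → IsFactorSequence A X ρ' →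
              ∀ F : ℝ → ℝ → ℂ, IsBoxTestFunction N F →
                ‖bilinearForm Ψ Q (heckeTwistedCoeff f ρ) (heckeTwistedCoeff f' ρ') F -
                    diagonalForm Ψ Q (heckeTwistedCoeff f ρ) (heckeTwistedCoeff f' ρ') F‖ ≤
                  c * Q * Real.log Q ^ (-C)

/-! ### Bookkeeping (proved) -/

/-- `a_0 = 0`. [cite: ConreyIwaniecSoundararajan2011ALS, §2 (2.5)] -/
theorem heckeTwistedCoeff_zero {k : ℤ} (f : CuspForm 𝒮ℒ k) (ρ : ℕ → ℂ) :
    heckeTwistedCoeff f ρ 0 = 0 := by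
  simp [heckeTwistedCoeff]

/-- With the trivial factor sequence `ρ = 𝟙_{r=1}` (i.e. `X = 1`, no mollifier) the coefficients are
`a_m = λ_f(m) m^{−1/2}`, the Dirichlet coefficients of `L(s + ½, f)` — the unmollified second moment
of the family. [cite: ConreyIwaniecSoundararajan2011ALS, §2 (2.5) with ρ = δ₁] -/
theorem heckeTwistedCoeff_delta_one {k : ℤ} (f : CuspForm 𝒮ℒ k) (m : ℕ) :
    heckeTwistedCoeff f (fun r => if r = 1 then 1 else 0) m =
      (((m : ℝ) ^ (-(1 / 2 : ℝ)) : ℝ) : ℂ) * heckeLambda f m := by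
  rcases Nat.eq_zero_or_pos m with rfl | hm
  · simp [heckeTwistedCoeff]
  unfold heckeTwistedCoeff
  congr 1
  rw [Finset.sum_eq_single (m, 1)]
  · simp
  · rintro ⟨l, r⟩ hd hne
    have hlr : l * r = m := (Nat.mem_divisorsAntidiagonal.1 hd).1
    by_cases hr : r = 1
    · subst hr
      simp only [mul_one] at hlr
      subst hlr
      exact (hne rfl).elim
    · simp [hr]
  · intro h
    exact absurd (Nat.mem_divisorsAntidiagonal.2 ⟨by simp, hm.ne'⟩) h

/-- The trivial factor sequence is a factor sequence of every length `X ≥ 1` (and every exponent `A`).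
[cite: ConreyIwaniecSoundararajan2011ALS, §2 (2.20)] -/
theorem isFactorSequence_delta_one {A X : ℝ} (hX : 1 ≤ X) :
    IsFactorSequence A X (fun r => if r = 1 then 1 else 0) := by
  refine ⟨fun r hr => ?_, fun r hr => ?_⟩
  · by_cases h : r = 1
    · subst h; exact ⟨le_rfl, by simpa using hX⟩
    · simp [h] at hr
  · by_cases h : r = 1
    · subst h
      simp
    · simp only [h, if_false, norm_zero]
      positivity

end AsymptoticLargeSieve

end Literature.NumberTheory.LFunctions
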